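import Mathlib
import Summits.Ventures.HodgeRepro2.T5DyadicExamples

/-!
# T5CyclotomicDyadic — the dyadic examples of N2.8.2(b)/(e) in number-field form

Tier-5 support (seat p3) for sub-step N2 of `route/T5-N2-route-3.md`, §N2.8.2: (b) «2 NEVER
RAMIFIES in F⁺ … so 2 is inert (g₂ = 1) or splits completely (g₂ = 3)»; (e) «Examples re-checked:
ℚ(ζ₇) — ord_7(2) = 3 ⟹ g₂ = 1; −7 ≡ 1 (mod 8) ⟹ 2 splits in ℚ(√−7) ⟹ |D| = 0; ℚ(ζ₉) — ord_9(2) = 6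
⟹ 2 inert in E, K = ℚ(√−3), 2 inert ⟹ |D| = 1».

`T5DyadicExamples` (p393543) recorded the congruences (`orderOf (2 : ZMod 7) = 3`,
`orderOf (2 : ZMod 9) = 6`).  This file turns them into statements about the rings of integers,
through Mathlib's ramification theory of cyclotomic fields
(`IsCyclotomicExtension.Rat.inertiaDeg_eq_of_not_dvd` / `ramificationIdx_eq_of_not_dvd`: for a
prime `p ∤ m` the inertia degree of `p` in `ℚ(ζ_m)` is the order of `p` modulo `m` and `e = 1`),
the multiplicativity of `e`, `f` in towers (`Ideal.ramificationIdx_tower`, `Ideal.inertiaDeg_tower`),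
the fundamental identity `∑ e·f = [L : K]` (`Ideal.sum_ramification_inertia_eq_finrank`) and its
Galois form `r·e·f = [L : K]` (`Ideal.ncard_primesOver_mul_ramificationIdxIn_mul_inertiaDegIn`).

`E` is ANY field with `IsCyclotomicExtension {7} ℚ E` (resp. `{9}`); `F`, `K` are ANY
intermediate fields of `E/ℚ` of degree `3`, resp. `2` — this covers the real cubic subfield `F⁺`
and the imaginary quadratic subfield `K` of the record (unique of their degrees by
`T5CyclicSubfields`, p393645).  The set `D` of the record is
`{𝔭 ∈ (2).primesOver (𝓞 F) | (𝔭.primesOver (𝓞 E)).ncard = 1}` («w non-split in E» read as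
«exactly one prime of E above w»).

§1 towers `ℚ ⊆ F ⊆ E` (any prime `p`): unramified above ⟹ unramified below and between; Galois
`E/F`: `r·(e·f) = [E : F]` (so `f ≤ [E : F]`); `e·f ≤ [F : ℚ]`; «every prime above `p` has
`e·f = [F : ℚ]` ⟹ one prime above `p`», «… `e·f = 1` ⟹ `[F : ℚ]` primes».  §2 `ℚ(ζ₇)`: `e = 1`,
`f = 3`, two primes above `2`; cubic `F`: `2` INERT (`g₂ = 1`), its dyadic prime splits in `E`,
`D = ∅`; quadratic `K`: `e = f = 1`, `2` SPLITS.  §3 `ℚ(ζ₉)`: `e = 1`, `f = 6`, `2` INERT in `E`,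
in the cubic `F` (one dyadic prime, non-split in `E`, `D` = all, `D.ncard = 1`) and in the
quadratic `K` (`f = 2`).

Honest scope — stays prose (labels unchanged): the conductor shape of a GENERAL cyclic cubic
(conductor–discriminant / Kronecker–Weber; only the two example fields are treated); that `F⁺_w`
IS the unramified cubic over `ℚ₂` (no completions); that `ℚ(√−7)` / `ℚ(√−3)` ARE the quadratic
subfields (any degree-2 intermediate field is treated).  Uses an L-value-free non-vanishing
device: NO (README §8(d)).
-/

namespace Summit.Ventures.HodgeRepro2.T5CyclotomicDyadic

open Ideal NumberField

/-! ## §1 Towers of number fields -/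

section Tower

variable {F E : Type*} [Field F] [NumberField F] [Field E] [NumberField E] [Algebra F E]

omit [NumberField E] in
/-- If `P` (a prime of `𝓞 E` above the prime `𝔭` of `𝓞 F`) is unramified over `ℤ`, then `𝔭`
is unramified over `ℤ` and `P` is unramified over `𝓞 F` — `e(P|p) = e(𝔭|p)·e(P|𝔭)`
(`Ideal.ramificationIdx_tower`) and a product of naturals is `1` only if both factors are. -/
theorem ramificationIdx_eq_one_of_tower (𝔭 : Ideal (𝓞 F)) (P : Ideal (𝓞 E)) [P.LiesOver 𝔭]
    (h : P.ramificationIdx ℤ = 1) :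
    𝔭.ramificationIdx ℤ = 1 ∧ P.ramificationIdx (𝓞 F) = 1 := by
  have htower := ramificationIdx_tower (R := ℤ) 𝔭 P
  rw [h] at htower
  exact ⟨Nat.eq_one_of_mul_eq_one_right htower.symm, Nat.eq_one_of_mul_eq_one_left htower.symm⟩

/-- Galois form of the fundamental identity for `E/F` at the prime `𝔭` of `𝓞 F`, with the
invariants read off one prime `P` above `𝔭`: `r·(e·f) = [E : F]`. -/
theorem ncard_primesOver_mul [IsGalois F E] (𝔭 : Ideal (𝓞 F)) [𝔭.IsPrime] (P : Ideal (𝓞 E))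
    [P.IsPrime] [P.LiesOver 𝔭] :
    (𝔭.primesOver (𝓞 E)).ncard * (P.ramificationIdx (𝓞 F) * P.inertiaDeg (𝓞 F)) =
      Module.finrank F E := by
  rw [← IsGaloisGroup.card_eq_finrank (E ≃ₐ[F] E) F E,
    ← ncard_primesOver_mul_ramificationIdxIn_mul_inertiaDegIn 𝔭 (𝓞 E) (E ≃ₐ[F] E),
    ramificationIdxIn_eq_ramificationIdx 𝔭 P (E ≃ₐ[F] E),
    inertiaDegIn_eq_inertiaDeg 𝔭 P (E ≃ₐ[F] E)]

/-- For Galois `E/F`, the relative inertia degree of a prime of `𝓞 E` divides `[E : F]`. -/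
theorem inertiaDeg_dvd_finrank_of_isGalois [IsGalois F E] (𝔭 : Ideal (𝓞 F)) [𝔭.IsPrime]
    (P : Ideal (𝓞 E)) [P.IsPrime] [P.LiesOver 𝔭] :
    P.inertiaDeg (𝓞 F) ∣ Module.finrank F E := by
  refine ⟨(𝔭.primesOver (𝓞 E)).ncard * P.ramificationIdx (𝓞 F), ?_⟩
  rw [← ncard_primesOver_mul 𝔭 P]
  ring

/-- For Galois `E/F`, the relative inertia degree of a prime of `𝓞 E` is at most `[E : F]`. -/
theorem inertiaDeg_le_finrank_of_isGalois [IsGalois F E] (𝔭 : Ideal (𝓞 F)) [𝔭.IsPrime]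
    (P : Ideal (𝓞 E)) [P.IsPrime] [P.LiesOver 𝔭] :
    P.inertiaDeg (𝓞 F) ≤ Module.finrank F E :=
  Nat.le_of_dvd Module.finrank_pos (inertiaDeg_dvd_finrank_of_isGalois 𝔭 P)

/-- The absolute inequality `e(𝔭|p)·f(𝔭|p) ≤ [F : ℚ]` — one term of the fundamental identity
`∑ e·f = [F : ℚ]` (`Ideal.sum_ramification_inertia_eq_finrank` + `RingOfIntegers.rank`). -/
theorem ramificationIdx_mul_inertiaDeg_le (p : Ideal ℤ) [p.IsPrime] (𝔭 : Ideal (𝓞 F))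
    [𝔭.IsPrime] [𝔭.LiesOver p] :
    𝔭.ramificationIdx ℤ * 𝔭.inertiaDeg ℤ ≤ Module.finrank ℚ F := by
  classical
  haveI : Finite (p.primesOver (𝓞 F)) := (Algebra.QuasiFinite.finite_primesOver p).to_subtype
  haveI := Fintype.ofFinite (p.primesOver (𝓞 F))
  have hsum := sum_ramification_inertia_eq_finrank p (𝓞 F)
  rw [RingOfIntegers.rank] at hsum
  rw [← hsum]
  exact Finset.single_le_sum
    (f := fun q : p.primesOver (𝓞 F) => q.1.ramificationIdx ℤ * q.1.inertiaDeg ℤ)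
    (fun _ _ => Nat.zero_le _) (Finset.mem_univ ⟨𝔭, inferInstance, inferInstance⟩)

/-- If every prime of `𝓞 F` above `p` has `e·f = [F : ℚ]`, there is exactly one prime above `p`
(the fundamental identity `∑ e·f = [F : ℚ]` forces the sum to have one term). -/
theorem ncard_primesOver_eq_one_of_forall (p : Ideal ℤ) [p.IsPrime]
    (h : ∀ 𝔭 ∈ p.primesOver (𝓞 F),
      𝔭.ramificationIdx ℤ * 𝔭.inertiaDeg ℤ = Module.finrank ℚ F) :
    (p.primesOver (𝓞 F)).ncard = 1 := by
  classical
  haveI : Finite (p.primesOver (𝓞 F)) := (Algebra.QuasiFinite.finite_primesOver p).to_subtype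
  haveI := Fintype.ofFinite (p.primesOver (𝓞 F))
  have hsum := sum_ramification_inertia_eq_finrank p (𝓞 F)
  rw [Finset.sum_eq_card_nsmul (fun q _ => h q.1 q.2), RingOfIntegers.rank, Finset.card_univ,
    smul_eq_mul] at hsum
  have hpos : 0 < Module.finrank ℚ F := Module.finrank_pos
  have hc : Fintype.card (p.primesOver (𝓞 F)) = 1 :=
    Nat.eq_of_mul_eq_mul_right hpos (hsum.trans (one_mul _).symm)
  rw [← Nat.card_coe_set_eq, Nat.card_eq_fintype_card, hc]

/-- If every prime of `𝓞 F` above `p` has `e·f = 1`, there are exactly `[F : ℚ]` primes above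
`p` («`p` splits completely»; the fundamental identity with all terms equal to `1`). -/
theorem ncard_primesOver_eq_finrank_of_forall (p : Ideal ℤ) [p.IsPrime]
    (h : ∀ 𝔭 ∈ p.primesOver (𝓞 F), 𝔭.ramificationIdx ℤ * 𝔭.inertiaDeg ℤ = 1) :
    (p.primesOver (𝓞 F)).ncard = Module.finrank ℚ F := by
  classical
  haveI : Finite (p.primesOver (𝓞 F)) := (Algebra.QuasiFinite.finite_primesOver p).to_subtype
  haveI := Fintype.ofFinite (p.primesOver (𝓞 F))
  have hsum := sum_ramification_inertia_eq_finrank p (𝓞 F)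
  rw [Finset.sum_eq_card_nsmul (fun q _ => h q.1 q.2), RingOfIntegers.rank, Finset.card_univ,
    smul_eq_mul, mul_one] at hsum
  rw [← Nat.card_coe_set_eq, Nat.card_eq_fintype_card, hsum]

end Tower

/-! ## §2 The example `ℚ(ζ₇)`: `2` is inert in the cubic subfield and splits in the quadratic one
(«ord_7(2) = 3 ⟹ g₂ = 1; 2 splits in ℚ(√−7) ⟹ |D| = 0»). -/

section Seven

/-- The ideal `(2)` of `ℤ` (maximal: `Int.ideal_span_isMaximal_of_prime`). -/
local notation3 "𝒑₂" => (span {((2 : ℕ) : ℤ)} : Ideal ℤ)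

variable (E : Type*) [Field E] [NumberField E] [IsCyclotomicExtension {7} ℚ E]

/-- `[ℚ(ζ₇) : ℚ] = φ(7) = 6`. -/
theorem finrank_seven : Module.finrank ℚ E = 6 := by
  rw [IsCyclotomicExtension.Rat.finrank 7 E]
  decide

/-- The inertia degree of every prime of `ℚ(ζ₇)` above `2` is `ord_7(2) = 3`
(`IsCyclotomicExtension.Rat.inertiaDeg_eq_of_not_dvd` + `T5DyadicExamples.orderOf_two_zmod_seven`). -/
theorem inertiaDeg_two_seven (P : Ideal (𝓞 E)) [P.IsPrime] [P.LiesOver 𝒑₂] :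
    P.inertiaDeg ℤ = 3 := by
  rw [IsCyclotomicExtension.Rat.inertiaDeg_eq_of_not_dvd (m := 7) 2 E P (by decide)]
  exact_mod_cast T5DyadicExamples.orderOf_two_zmod_seven

/-- `2` is unramified in `ℚ(ζ₇)` (`2 ∤ 7`). -/
theorem ramificationIdx_two_seven (P : Ideal (𝓞 E)) [P.IsPrime] [P.LiesOver 𝒑₂] :
    P.ramificationIdx ℤ = 1 :=
  IsCyclotomicExtension.Rat.ramificationIdx_eq_of_not_dvd (m := 7) 2 E P (by decide)

/-- `2` has exactly `6 / (1·3) = 2` primes above it in `ℚ(ζ₇)` (Galois fundamental identity). -/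
theorem ncard_primesOver_two_seven : (𝒑₂.primesOver (𝓞 E)).ncard = 2 := by
  haveI : IsGalois ℚ E := IsCyclotomicExtension.isGalois {7} ℚ E
  obtain ⟨⟨P, hP, hP₂⟩⟩ := 𝒑₂.nonempty_primesOver (S := 𝓞 E)
  have h := ncard_primesOver_mul_ramificationIdxIn_mul_inertiaDegIn 𝒑₂ (𝓞 E) (E ≃ₐ[ℚ] E)
  rw [ramificationIdxIn_eq_ramificationIdx 𝒑₂ P (E ≃ₐ[ℚ] E),
    inertiaDegIn_eq_inertiaDeg 𝒑₂ P (E ≃ₐ[ℚ] E), ramificationIdx_two_seven E P,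
    inertiaDeg_two_seven E P, IsGaloisGroup.card_eq_finrank (E ≃ₐ[ℚ] E) ℚ E, finrank_seven E] at h
  omega

variable (F : IntermediateField ℚ E)

/-- A cubic intermediate field of `ℚ(ζ₇)` has `[E : F] = 2`. -/
theorem finrank_top_of_cubic_seven (hF : Module.finrank ℚ F = 3) : Module.finrank F E = 2 := by
  have h := Module.finrank_mul_finrank ℚ F E
  rw [hF, finrank_seven E] at h
  omega

/-- In a cubic intermediate field `F` of `ℚ(ζ₇)` (the real cubic subfield `F⁺`), every prime
above `2` has inertia degree `3` and ramification index `1`: from `3 = f(P|2) = f(𝔭|2)·f(P|𝔭)`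
with `f(P|𝔭) ≤ [E : F] = 2`, and `e(P|2) = 1`. -/
theorem inertiaDeg_two_cubic_seven (hF : Module.finrank ℚ F = 3) (𝔭 : Ideal (𝓞 F)) [𝔭.IsPrime]
    [𝔭.LiesOver 𝒑₂] : 𝔭.inertiaDeg ℤ = 3 ∧ 𝔭.ramificationIdx ℤ = 1 := by
  haveI : IsGalois ℚ E := IsCyclotomicExtension.isGalois {7} ℚ E
  obtain ⟨⟨P, hP, hPF⟩⟩ := 𝔭.nonempty_primesOver (S := 𝓞 E)
  haveI : P.LiesOver 𝒑₂ := LiesOver.trans P 𝔭 𝒑₂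
  have hf := inertiaDeg_tower (R := ℤ) 𝔭 P
  rw [inertiaDeg_two_seven E P] at hf
  have hle : P.inertiaDeg (𝓞 F) ≤ 2 :=
    finrank_top_of_cubic_seven E F hF ▸ inertiaDeg_le_finrank_of_isGalois 𝔭 P
  have hpos : 0 < P.inertiaDeg (𝓞 F) := inertiaDeg_pos P (𝓞 F)
  refine ⟨?_, (ramificationIdx_eq_one_of_tower 𝔭 P (ramificationIdx_two_seven E P)).1⟩
  interval_cases P.inertiaDeg (𝓞 F) <;> omega

/-- `2` is INERT in the cubic subfield of `ℚ(ζ₇)`: exactly one prime of `𝓞 F` above `2`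
(«ord_7(2) = 3 ⟹ g₂ = 1»). -/
theorem ncard_primesOver_two_cubic_seven (hF : Module.finrank ℚ F = 3) :
    (𝒑₂.primesOver (𝓞 F)).ncard = 1 :=
  ncard_primesOver_eq_one_of_forall 𝒑₂ fun 𝔭 h𝔭 => by
    haveI := h𝔭.1
    haveI := h𝔭.2
    obtain ⟨hf, he⟩ := inertiaDeg_two_cubic_seven E F hF 𝔭
    rw [hf, he, hF]

/-- The dyadic prime of the cubic subfield of `ℚ(ζ₇)` SPLITS in `E`: exactly `[E : F] = 2` primes
of `𝓞 E` above it (`e(P|𝔭) = f(P|𝔭) = 1`). -/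
theorem ncard_primesOver_cubic_seven (hF : Module.finrank ℚ F = 3) (𝔭 : Ideal (𝓞 F)) [𝔭.IsPrime]
    [𝔭.LiesOver 𝒑₂] : (𝔭.primesOver (𝓞 E)).ncard = 2 := by
  haveI : IsGalois ℚ E := IsCyclotomicExtension.isGalois {7} ℚ E
  obtain ⟨⟨P, hP, hPF⟩⟩ := 𝔭.nonempty_primesOver (S := 𝓞 E)
  haveI : P.LiesOver 𝒑₂ := LiesOver.trans P 𝔭 𝒑₂
  have h := ncard_primesOver_mul 𝔭 P
  have hf := inertiaDeg_tower (R := ℤ) 𝔭 P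
  rw [inertiaDeg_two_seven E P, (inertiaDeg_two_cubic_seven E F hF 𝔭).1] at hf
  have hf' : P.inertiaDeg (𝓞 F) = 1 := by omega
  rw [(ramificationIdx_eq_one_of_tower 𝔭 P (ramificationIdx_two_seven E P)).2, hf',
    finrank_top_of_cubic_seven E F hF] at h
  omega

/-- `D = ∅` for `ℚ(ζ₇)`: no dyadic place of the cubic subfield is non-split in `E` («|D| = 0»). -/
theorem nonSplit_seven (hF : Module.finrank ℚ F = 3) :
    {𝔭 ∈ 𝒑₂.primesOver (𝓞 F) | (𝔭.primesOver (𝓞 E)).ncard = 1} = ∅ := by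
  rw [Set.sep_eq_empty_iff_mem_false]
  intro 𝔭 h𝔭
  haveI := h𝔭.1
  haveI := h𝔭.2
  rw [ncard_primesOver_cubic_seven E F hF 𝔭]
  decide

variable (K : IntermediateField ℚ E)

/-- In a quadratic intermediate field `K` of `ℚ(ζ₇)` (`K = ℚ(√−7)`), every prime above `2` has
`e = f = 1`: `f(𝔮|2)` divides `f(P|2) = 3` and `e·f ≤ [K : ℚ] = 2`. -/
theorem inertiaDeg_two_quadratic_seven (hK : Module.finrank ℚ K = 2) (𝔮 : Ideal (𝓞 K))
    [𝔮.IsPrime] [𝔮.LiesOver 𝒑₂] : 𝔮.inertiaDeg ℤ = 1 ∧ 𝔮.ramificationIdx ℤ = 1 := by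
  obtain ⟨⟨P, hP, hPK⟩⟩ := 𝔮.nonempty_primesOver (S := 𝓞 E)
  haveI : P.LiesOver 𝒑₂ := LiesOver.trans P 𝔮 𝒑₂
  have hf := inertiaDeg_tower (R := ℤ) 𝔮 P
  rw [inertiaDeg_two_seven E P] at hf
  have he := (ramificationIdx_eq_one_of_tower 𝔮 P (ramificationIdx_two_seven E P)).1
  have hle := ramificationIdx_mul_inertiaDeg_le 𝒑₂ 𝔮
  rw [he, one_mul, hK] at hle
  have hpos : 0 < 𝔮.inertiaDeg ℤ := inertiaDeg_pos 𝔮 ℤ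
  refine ⟨?_, he⟩
  interval_cases 𝔮.inertiaDeg ℤ <;> omega

/-- `2` SPLITS in the quadratic subfield of `ℚ(ζ₇)`: exactly `[K : ℚ] = 2` primes above `2`
(«−7 ≡ 1 (mod 8) ⟹ 2 splits in ℚ(√−7)», now read off the inertia degrees). -/
theorem ncard_primesOver_two_quadratic_seven (hK : Module.finrank ℚ K = 2) :
    (𝒑₂.primesOver (𝓞 K)).ncard = 2 :=
  (ncard_primesOver_eq_finrank_of_forall 𝒑₂ fun 𝔮 h𝔮 => by
    haveI := h𝔮.1
    haveI := h𝔮.2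
    obtain ⟨hf, he⟩ := inertiaDeg_two_quadratic_seven E K hK 𝔮
    rw [hf, he]).trans hK

end Seven

/-! ## §3 The example `ℚ(ζ₉)`: `2` is inert in `E`, hence in both subfields, and `|D| = 1`
(«ord_9(2) = 6 ⟹ 2 inert in E, K = ℚ(√−3), 2 inert ⟹ |D| = 1»). -/

section Nine

local notation3 "𝒑₂" => (span {((2 : ℕ) : ℤ)} : Ideal ℤ)

variable (E : Type*) [Field E] [NumberField E] [IsCyclotomicExtension {9} ℚ E]

/-- `[ℚ(ζ₉) : ℚ] = φ(9) = 6`. -/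
theorem finrank_nine : Module.finrank ℚ E = 6 := by
  rw [IsCyclotomicExtension.Rat.finrank 9 E]
  decide

/-- The inertia degree of every prime of `ℚ(ζ₉)` above `2` is `ord_9(2) = 6`
(`T5DyadicExamples.orderOf_two_zmod_nine`). -/
theorem inertiaDeg_two_nine (P : Ideal (𝓞 E)) [P.IsPrime] [P.LiesOver 𝒑₂] :
    P.inertiaDeg ℤ = 6 := by
  rw [IsCyclotomicExtension.Rat.inertiaDeg_eq_of_not_dvd (m := 9) 2 E P (by decide)]
  exact_mod_cast T5DyadicExamples.orderOf_two_zmod_nine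

/-- `2` is unramified in `ℚ(ζ₉)` (`2 ∤ 9`). -/
theorem ramificationIdx_two_nine (P : Ideal (𝓞 E)) [P.IsPrime] [P.LiesOver 𝒑₂] :
    P.ramificationIdx ℤ = 1 :=
  IsCyclotomicExtension.Rat.ramificationIdx_eq_of_not_dvd (m := 9) 2 E P (by decide)

/-- `2` is INERT in `ℚ(ζ₉)`: exactly `6 / (1·6) = 1` prime above it. -/
theorem ncard_primesOver_two_nine : (𝒑₂.primesOver (𝓞 E)).ncard = 1 := by
  haveI : IsGalois ℚ E := IsCyclotomicExtension.isGalois {9} ℚ E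
  obtain ⟨⟨P, hP, hP₂⟩⟩ := 𝒑₂.nonempty_primesOver (S := 𝓞 E)
  have h := ncard_primesOver_mul_ramificationIdxIn_mul_inertiaDegIn 𝒑₂ (𝓞 E) (E ≃ₐ[ℚ] E)
  rw [ramificationIdxIn_eq_ramificationIdx 𝒑₂ P (E ≃ₐ[ℚ] E),
    inertiaDegIn_eq_inertiaDeg 𝒑₂ P (E ≃ₐ[ℚ] E), ramificationIdx_two_nine E P,
    inertiaDeg_two_nine E P, IsGaloisGroup.card_eq_finrank (E ≃ₐ[ℚ] E) ℚ E, finrank_nine E] at h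
  omega

variable (F : IntermediateField ℚ E)

/-- A cubic intermediate field of `ℚ(ζ₉)` has `[E : F] = 2`. -/
theorem finrank_top_of_cubic_nine (hF : Module.finrank ℚ F = 3) : Module.finrank F E = 2 := by
  have h := Module.finrank_mul_finrank ℚ F E
  rw [hF, finrank_nine E] at h
  omega

/-- In a cubic intermediate field `F` of `ℚ(ζ₉)`, every prime above `2` has `f = 3`, `e = 1`, and
the prime `P` of `E` above it has `f(P|𝔭) = 2`: from `6 = f(𝔭|2)·f(P|𝔭)`, `f(P|𝔭) ≤ 2` and
`f(𝔭|2) ≤ 3`. -/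
theorem inertiaDeg_two_cubic_nine (hF : Module.finrank ℚ F = 3) (𝔭 : Ideal (𝓞 F)) [𝔭.IsPrime]
    [𝔭.LiesOver 𝒑₂] (P : Ideal (𝓞 E)) [P.IsPrime] [P.LiesOver 𝔭] :
    𝔭.inertiaDeg ℤ = 3 ∧ 𝔭.ramificationIdx ℤ = 1 ∧ P.inertiaDeg (𝓞 F) = 2 := by
  haveI : IsGalois ℚ E := IsCyclotomicExtension.isGalois {9} ℚ E
  haveI : P.LiesOver 𝒑₂ := LiesOver.trans P 𝔭 𝒑₂
  have hf := inertiaDeg_tower (R := ℤ) 𝔭 P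
  rw [inertiaDeg_two_nine E P] at hf
  have hle : P.inertiaDeg (𝓞 F) ≤ 2 :=
    finrank_top_of_cubic_nine E F hF ▸ inertiaDeg_le_finrank_of_isGalois 𝔭 P
  have hpos : 0 < P.inertiaDeg (𝓞 F) := inertiaDeg_pos P (𝓞 F)
  have he := (ramificationIdx_eq_one_of_tower 𝔭 P (ramificationIdx_two_nine E P)).1
  have hle' := ramificationIdx_mul_inertiaDeg_le 𝒑₂ 𝔭
  rw [he, one_mul, hF] at hle'
  refine ⟨?_, he, ?_⟩ <;> interval_cases P.inertiaDeg (𝓞 F) <;> omega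

/-- `2` is INERT in the cubic subfield of `ℚ(ζ₉)`: exactly one prime of `𝓞 F` above `2`. -/
theorem ncard_primesOver_two_cubic_nine (hF : Module.finrank ℚ F = 3) :
    (𝒑₂.primesOver (𝓞 F)).ncard = 1 :=
  ncard_primesOver_eq_one_of_forall 𝒑₂ fun 𝔭 h𝔭 => by
    haveI := h𝔭.1
    haveI := h𝔭.2
    obtain ⟨⟨P, hP, hPF⟩⟩ := 𝔭.nonempty_primesOver (S := 𝓞 E)
    obtain ⟨hf, he, -⟩ := inertiaDeg_two_cubic_nine E F hF 𝔭 P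
    rw [hf, he, hF]

/-- The dyadic prime of the cubic subfield of `ℚ(ζ₉)` is NON-SPLIT in `E`: exactly one prime of
`𝓞 E` above it (`e(P|𝔭) = 1`, `f(P|𝔭) = 2 = [E : F]`). -/
theorem ncard_primesOver_cubic_nine (hF : Module.finrank ℚ F = 3) (𝔭 : Ideal (𝓞 F)) [𝔭.IsPrime]
    [𝔭.LiesOver 𝒑₂] : (𝔭.primesOver (𝓞 E)).ncard = 1 := by
  haveI : IsGalois ℚ E := IsCyclotomicExtension.isGalois {9} ℚ E
  obtain ⟨⟨P, hP, hPF⟩⟩ := 𝔭.nonempty_primesOver (S := 𝓞 E)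
  haveI : P.LiesOver 𝒑₂ := LiesOver.trans P 𝔭 𝒑₂
  have h := ncard_primesOver_mul 𝔭 P
  obtain ⟨-, -, hf'⟩ := inertiaDeg_two_cubic_nine E F hF 𝔭 P
  rw [(ramificationIdx_eq_one_of_tower 𝔭 P (ramificationIdx_two_nine E P)).2, hf',
    finrank_top_of_cubic_nine E F hF] at h
  omega

/-- `D` = all dyadic places for `ℚ(ζ₉)`: every dyadic prime of the cubic subfield is non-split
in `E`. -/
theorem nonSplit_nine_eq (hF : Module.finrank ℚ F = 3) :
    {𝔭 ∈ 𝒑₂.primesOver (𝓞 F) | (𝔭.primesOver (𝓞 E)).ncard = 1} = 𝒑₂.primesOver (𝓞 F) := by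
  rw [Set.sep_eq_self_iff_mem_true]
  intro 𝔭 h𝔭
  haveI := h𝔭.1
  haveI := h𝔭.2
  exact ncard_primesOver_cubic_nine E F hF 𝔭

/-- `|D| = 1` for `ℚ(ζ₉)`: the cubic subfield has one dyadic place and it is non-split in `E`. -/
theorem nonSplit_nine (hF : Module.finrank ℚ F = 3) :
    {𝔭 ∈ 𝒑₂.primesOver (𝓞 F) | (𝔭.primesOver (𝓞 E)).ncard = 1}.ncard = 1 := by
  rw [nonSplit_nine_eq E F hF, ncard_primesOver_two_cubic_nine E F hF]

variable (K : IntermediateField ℚ E)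

/-- A quadratic intermediate field of `ℚ(ζ₉)` has `[E : K] = 3`. -/
theorem finrank_top_of_quadratic_nine (hK : Module.finrank ℚ K = 2) :
    Module.finrank K E = 3 := by
  have h := Module.finrank_mul_finrank ℚ K E
  rw [hK, finrank_nine E] at h
  omega

/-- In a quadratic intermediate field `K` of `ℚ(ζ₉)` (`K = ℚ(√−3)`), every prime above `2` has
`f = 2`, `e = 1`: from `6 = f(𝔮|2)·f(P|𝔮)`, `f(P|𝔮) ≤ 3` and `f(𝔮|2) ≤ 2`. -/
theorem inertiaDeg_two_quadratic_nine (hK : Module.finrank ℚ K = 2) (𝔮 : Ideal (𝓞 K))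
    [𝔮.IsPrime] [𝔮.LiesOver 𝒑₂] : 𝔮.inertiaDeg ℤ = 2 ∧ 𝔮.ramificationIdx ℤ = 1 := by
  haveI : IsGalois ℚ E := IsCyclotomicExtension.isGalois {9} ℚ E
  obtain ⟨⟨P, hP, hPK⟩⟩ := 𝔮.nonempty_primesOver (S := 𝓞 E)
  haveI : P.LiesOver 𝒑₂ := LiesOver.trans P 𝔮 𝒑₂
  have hf := inertiaDeg_tower (R := ℤ) 𝔮 P
  rw [inertiaDeg_two_nine E P] at hf
  have hle : P.inertiaDeg (𝓞 K) ≤ 3 :=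
    finrank_top_of_quadratic_nine E K hK ▸ inertiaDeg_le_finrank_of_isGalois 𝔮 P
  have hpos : 0 < P.inertiaDeg (𝓞 K) := inertiaDeg_pos P (𝓞 K)
  have he := (ramificationIdx_eq_one_of_tower 𝔮 P (ramificationIdx_two_nine E P)).1
  have hle' := ramificationIdx_mul_inertiaDeg_le 𝒑₂ 𝔮
  rw [he, one_mul, hK] at hle'
  refine ⟨?_, he⟩
  interval_cases P.inertiaDeg (𝓞 K) <;> omega

/-- `2` is INERT in the quadratic subfield of `ℚ(ζ₉)` (`K = ℚ(√−3)`): exactly one prime above `2`. -/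
theorem ncard_primesOver_two_quadratic_nine (hK : Module.finrank ℚ K = 2) :
    (𝒑₂.primesOver (𝓞 K)).ncard = 1 :=
  ncard_primesOver_eq_one_of_forall 𝒑₂ fun 𝔮 h𝔮 => by
    haveI := h𝔮.1
    haveI := h𝔮.2
    obtain ⟨hf, he⟩ := inertiaDeg_two_quadratic_nine E K hK 𝔮
    rw [hf, he, hK]

end Nine

end Summit.Ventures.HodgeRepro2.T5CyclotomicDyadic
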